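import Mathlib
import Summits.NavierStokesRegularity.NavierStokesRegularity.Theorems.EulerZoomLiouvillePowerGaugeEulerLiouvilleSelfSimilarSwirlRatchet
import Literature.Analysis.FluidPDE.TaoEnstrophyLocalisationProofs
import Literature.Analysis.FluidPDE.AxisymVorticityAlgebra
import Literature.Analysis.FunctionSpaces.SobolevDomainProofs
import HarnessLib

/-!
# Crux E `PowerGaugeEulerLiouville` (stmt-NavierStokesRegularity-19832), THE ONE STATEMENT: the `E`-GAUGE HARDY BOUND ON THE SWIRL of an axisymmetric profile —
# `∫ Γ² r⁻⁴ |y|^{ρ−1} dy ≤ ((1−ρ)/(2+ρ))·c` and `∫ |V_h|² r⁻² |y|^{ρ−1} dy ≤ ((1−ρ)/(2+ρ))·c` (T1 tool; width seat ns-ezl-w3 g3)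

Route №10 `EulerZoomLiouville` (NavierStokesRegularity), crux E; LEAD ns-typeII-p2 g12; target T1 of RESIDUE-MEMO §2 («an estimate coupling Γ-growth to ℋ or to the E-gauge»).
The infinitesimal axisymmetry `DV(x)[Jx] = J V(x)` (`IsAxisymmetric.fderiv_rotGen`, `J` = `rotGen`, `‖Jx‖ = r`) gives the pointwise HARDY-TYPE inequalities
`|V_h(x)|² = ‖J V(x)‖² ≤ r² ‖DV(x)‖² ≤ r² |DV(x)|²_F` (`normSq_horizontal_le_sq_cylRadius_mul`) and, by Lagrange's identity `Γ² + (x_h·V_h)² = r²|V_h|²`,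
`Γ(x)² ≤ r⁴ |DV(x)|²_F` (`sq_swirl_le_cylRadius_pow_four_mul`; compare the tree's sup-form `|Γ| ≤ ½ r² sup‖curl V‖`).  Read against the lineage's `E`-gauge dictionary
(`EnergySaturation.profileData_of_selfSimilar`: a weak gradient `G` of the profile with `∫ |G|²_F |y|^{ρ−1} ≤ ((1−ρ)/(2+ρ)) c`, and `G = DV` a.e. for `V ∈ C¹` by
`HasWeakFDerivOn.unique_holds` / `.of_contDiff_holds`) this is, for every exactly self-similar member with an axisymmetric `C²` profile (crux binders VERBATIM, `0 < ρ < 1`):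

* `lintegral_sq_swirl_hardy_le` — **`∫⁻ ofReal(Γ(y)²/r(y)⁴ · ‖y‖^{ρ−1}) ≤ ofReal((1−ρ)/(2+ρ)) · c`** (the swirl is `E`-expensive NEAR THE AXIS and in the near field);
* `lintegral_normSq_horizontal_hardy_le` — **`∫⁻ ofReal((V₀² + V₁²)(y)/r(y)² · ‖y‖^{ρ−1}) ≤ ofReal((1−ρ)/(2+ρ)) · c`** (the whole horizontal velocity, swirl or not).

For the next T1 hand: together with the `A`-growth `∫_{B_R}|V|² ≤ cR^{1−2ρ}` (so `∫_{B_R} Γ²/r² ≤ cR^{3−2ρ}`), the exact volume law `vol{|Γ|>μe^{−ργs}} = e^{3γs}vol{|Γ|>μ}`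
((C3)/(C5)), swirl piercing ((T)/(T2): vortical strict-inflow swirl maxima on every sphere, rate law) this is the quantitative frame in which the axisymmetric needle lives.
WHAT THIS IS NOT: not NS regularity, not the crux E, not a kill — a tool toward T1 for the registered residue of the crux CLASS 19832 (MODEL lattice; E/NS strata),
`--supports` stmt-19832; 19832 OPEN. [folklore; CaffarelliKohnNirenberg1982 §2 (`E`-quantity); MajdaBertozziCUP2002 §2.3.3]
-/

noncomputable section

-- flat `Theorems/<Route><Decl>…` files of one crux share the namespace of the crux (tree convention: `Summit.<S>.<S>.…`)
set_option linter.dupNamespace false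

open MeasureTheory Set Filter Topology Metric Function InnerProductSpace
open scoped RealInnerProductSpace NNReal ENNReal ContDiff

namespace Summit.NavierStokesRegularity.NavierStokesRegularity.Theorems.PowerGaugeEulerLiouville

open Literature.Analysis Literature.Analysis.FluidPDE Literature.Analysis.FunctionSpaces

namespace SwirlRatchet

variable {U : EuclideanSpace ℝ (Fin 3) → EuclideanSpace ℝ (Fin 3)}

/-! ### Pointwise Hardy inequalities from the infinitesimal axisymmetry -/

/-- **`|V_h(x)|² ≤ r(x)² |DV(x)|²_F`** for an axisymmetric field differentiable at `x` (`J V(x) = DV(x)[Jx]`, `‖Jx‖ = r(x)`, operator norm ≤ Frobenius norm).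
[cite: MajdaBertozziCUP2002, §2.3.3] -/
theorem normSq_horizontal_le_sq_cylRadius_mul (hU : IsAxisymmetric U) {x : EuclideanSpace ℝ (Fin 3)} (hd : DifferentiableAt ℝ U x) :
    U x 0 ^ 2 + U x 1 ^ 2 ≤ cylRadius x ^ 2 * frobeniusNormSq (fderiv ℝ U x) := by
  have h1 : ‖rotGen (U x)‖ ≤ ‖fderiv ℝ U x‖ * ‖rotGen x‖ := by
    rw [← hU.fderiv_rotGen hd]; exact ContinuousLinearMap.le_opNorm _ _
  have h2 : ‖rotGen (U x)‖ ^ 2 ≤ ‖fderiv ℝ U x‖ ^ 2 * ‖rotGen x‖ ^ 2 := by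
    rw [← mul_pow]; exact pow_le_pow_left₀ (norm_nonneg _) h1 2
  rw [norm_rotGen_sq, norm_rotGen_sq, ← cylRadius_sq x] at h2
  calc U x 0 ^ 2 + U x 1 ^ 2 ≤ ‖fderiv ℝ U x‖ ^ 2 * cylRadius x ^ 2 := h2
    _ ≤ frobeniusNormSq (fderiv ℝ U x) * cylRadius x ^ 2 :=
        mul_le_mul_of_nonneg_right (sq_opNorm_le_frobeniusNormSq _) (sq_nonneg _)
    _ = cylRadius x ^ 2 * frobeniusNormSq (fderiv ℝ U x) := mul_comm _ _

/-- **`Γ(x)² ≤ r(x)⁴ |DV(x)|²_F`** for an axisymmetric field differentiable at `x` (Lagrange: `Γ² ≤ r²|V_h|²`, then the previous bound). [cite: MajdaBertozziCUP2002, §2.3.3] -/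
theorem sq_swirl_le_cylRadius_pow_four_mul (hU : IsAxisymmetric U) {x : EuclideanSpace ℝ (Fin 3)} (hd : DifferentiableAt ℝ U x) :
    swirl U x ^ 2 ≤ cylRadius x ^ 4 * frobeniusNormSq (fderiv ℝ U x) := by
  have hL : swirl U x ^ 2 ≤ cylRadius x ^ 2 * (U x 0 ^ 2 + U x 1 ^ 2) := by
    rw [cylRadius_sq]
    simp only [swirl]
    nlinarith [sq_nonneg (x 0 * U x 0 + x 1 * U x 1)]
  calc swirl U x ^ 2 ≤ cylRadius x ^ 2 * (U x 0 ^ 2 + U x 1 ^ 2) := hL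
    _ ≤ cylRadius x ^ 2 * (cylRadius x ^ 2 * frobeniusNormSq (fderiv ℝ U x)) :=
        mul_le_mul_of_nonneg_left (normSq_horizontal_le_sq_cylRadius_mul hU hd) (sq_nonneg _)
    _ = cylRadius x ^ 4 * frobeniusNormSq (fderiv ℝ U x) := by ring

/-- `Γ²/r⁴ ≤ |DV|²_F` everywhere (on the axis the left side is `0`). [folklore] -/
theorem sq_swirl_div_le_frobeniusNormSq (hU : IsAxisymmetric U) {x : EuclideanSpace ℝ (Fin 3)} (hd : DifferentiableAt ℝ U x) :
    swirl U x ^ 2 / cylRadius x ^ 4 ≤ frobeniusNormSq (fderiv ℝ U x) := by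
  rcases eq_or_ne (cylRadius x) 0 with hr | hr
  · rw [hr]; simp [frobeniusNormSq_nonneg]
  · rw [div_le_iff₀ (by positivity), mul_comm]
    exact sq_swirl_le_cylRadius_pow_four_mul hU hd

/-- `|V_h|²/r² ≤ |DV|²_F` everywhere (on the axis the left side is `0`). [folklore] -/
theorem normSq_horizontal_div_le_frobeniusNormSq (hU : IsAxisymmetric U) {x : EuclideanSpace ℝ (Fin 3)} (hd : DifferentiableAt ℝ U x) :
    (U x 0 ^ 2 + U x 1 ^ 2) / cylRadius x ^ 2 ≤ frobeniusNormSq (fderiv ℝ U x) := by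
  rcases eq_or_ne (cylRadius x) 0 with hr | hr
  · rw [hr]; simp [frobeniusNormSq_nonneg]
  · rw [div_le_iff₀ (by positivity), mul_comm]
    exact normSq_horizontal_le_sq_cylRadius_mul hU hd

end SwirlRatchet

/-! ### The weighted bounds for a class profile -/

namespace SwirlRatchet

variable {u : ℝ → EuclideanSpace ℝ (Fin 3) → EuclideanSpace ℝ (Fin 3)} {p : ℝ → EuclideanSpace ℝ (Fin 3) → ℝ}
  {H : ℝ → EuclideanSpace ℝ (Fin 3) → EuclideanSpace ℝ (Fin 3) →L[ℝ] EuclideanSpace ℝ (Fin 3)} {c : ℝ≥0}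
  {V : EuclideanSpace ℝ (Fin 3) → EuclideanSpace ℝ (Fin 3)} {P : EuclideanSpace ℝ (Fin 3) → ℝ}

/-- The `E`-weight of a `C¹` profile's CLASSICAL gradient (the lineage's dictionary gives it for a weak gradient `G`; `G = DV` a.e. by uniqueness of weak derivatives).
[cite: CaffarelliKohnNirenberg1982, §2] -/
theorem lintegral_frobeniusNormSq_fderiv_weight_le {ρ : ℝ} (hρ : 0 < ρ) (hρ1 : ρ < 1)
    (hsw : IsSuitableWeakSolutionOn (slab (EuclideanSpace ℝ (Fin 3)) (Iio 0) isOpen_Iio) 0 0 u p)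
    (hH : HasWeakSpatialGradientOn (slab (EuclideanSpace ℝ (Fin 3)) (Iio 0) isOpen_Iio) u H)
    (hgauge : ∀ a : ℝ, 0 < a →
      ENNReal.ofReal (a ^ (2 * ρ)) * cknA a (0 : ℝ × EuclideanSpace ℝ (Fin 3)) u +
          ENNReal.ofReal (a ^ ρ) * cknE a (0 : ℝ × EuclideanSpace ℝ (Fin 3)) H +
        ENNReal.ofReal (a ^ (2 * ρ)) * cknD a (0 : ℝ × EuclideanSpace ℝ (Fin 3)) p ≤ (c : ENNReal))
    (hu : ∀ τ : ℝ, τ < 0 → u τ = selfSimilarCollapse (1 / (2 + ρ)) 0 V τ)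
    (hp : ∀ τ : ℝ, τ < 0 → p τ = selfSimilarCollapsePressure (1 / (2 + ρ)) 0 P τ)
    (hV : ContDiff ℝ 1 V) :
    ∫⁻ y, ENNReal.ofReal (frobeniusNormSq (fderiv ℝ V y)) * ENNReal.ofReal (‖y‖ ^ (ρ - 1)) ≤
      ENNReal.ofReal ((1 - ρ) / (2 + ρ)) * (c : ℝ≥0∞) := by
  obtain ⟨G, -, -, -, -, hVG, -, hE, -⟩ := EnergySaturation.profileData_of_selfSimilar hρ hρ1 hsw hH hgauge hu hp
  have hae : G =ᵐ[volume] fderiv ℝ V := by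
    have h := Literature.Analysis.FunctionSpaces.HasWeakFDerivOn.unique_holds hVG
      (Literature.Analysis.FunctionSpaces.HasWeakFDerivOn.of_contDiff_holds ⊤ volume hV)
    rwa [TopologicalSpace.Opens.coe_top, Measure.restrict_univ] at h
  refine le_trans (le_of_eq (lintegral_congr_ae ?_)) hE
  filter_upwards [hae] with y hy
  rw [hy]

/-- **THE `E`-HARDY SWIRL BOUND**: for an exactly self-similar member of the class (crux binders VERBATIM, `0 < ρ < 1`) with an axisymmetric `C²` profile `V`,
`∫⁻ ofReal(Γ(y)² / r(y)⁴ · ‖y‖^{ρ−1}) ≤ ofReal((1−ρ)/(2+ρ)) · c`, `Γ = swirl V = rV_θ`. [cite: CaffarelliKohnNirenberg1982, §2 (`E`-quantity); MajdaBertozziCUP2002 §2.3.3] -/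
theorem lintegral_sq_swirl_hardy_le {ρ : ℝ} (hρ : 0 < ρ) (hρ1 : ρ < 1)
    (hsw : IsSuitableWeakSolutionOn (slab (EuclideanSpace ℝ (Fin 3)) (Iio 0) isOpen_Iio) 0 0 u p)
    (hH : HasWeakSpatialGradientOn (slab (EuclideanSpace ℝ (Fin 3)) (Iio 0) isOpen_Iio) u H)
    (hgauge : ∀ a : ℝ, 0 < a →
      ENNReal.ofReal (a ^ (2 * ρ)) * cknA a (0 : ℝ × EuclideanSpace ℝ (Fin 3)) u +
          ENNReal.ofReal (a ^ ρ) * cknE a (0 : ℝ × EuclideanSpace ℝ (Fin 3)) H +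
        ENNReal.ofReal (a ^ (2 * ρ)) * cknD a (0 : ℝ × EuclideanSpace ℝ (Fin 3)) p ≤ (c : ENNReal))
    (hu : ∀ τ : ℝ, τ < 0 → u τ = selfSimilarCollapse (1 / (2 + ρ)) 0 V τ)
    (hp : ∀ τ : ℝ, τ < 0 → p τ = selfSimilarCollapsePressure (1 / (2 + ρ)) 0 P τ)
    (hV : ContDiff ℝ 2 V) (hax : IsAxisymmetric V) :
    ∫⁻ y, ENNReal.ofReal (swirl V y ^ 2 / cylRadius y ^ 4 * ‖y‖ ^ (ρ - 1)) ≤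
      ENNReal.ofReal ((1 - ρ) / (2 + ρ)) * (c : ℝ≥0∞) := by
  have hV1 : ContDiff ℝ 1 V := hV.of_le (by norm_num)
  have hd : Differentiable ℝ V := hV1.differentiable (by norm_num)
  refine le_trans (lintegral_mono fun y => ?_) (lintegral_frobeniusNormSq_fderiv_weight_le hρ hρ1 hsw hH hgauge hu hp hV1)
  rw [ENNReal.ofReal_mul (div_nonneg (sq_nonneg _) (pow_nonneg (cylRadius_nonneg _) 4))]
  exact mul_le_mul' (ENNReal.ofReal_le_ofReal (sq_swirl_div_le_frobeniusNormSq hax (hd y))) le_rfl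

/-- **THE `E`-HARDY BOUND ON THE HORIZONTAL VELOCITY**: same setting, `∫⁻ ofReal((V₀² + V₁²)(y) / r(y)² · ‖y‖^{ρ−1}) ≤ ofReal((1−ρ)/(2+ρ)) · c`.
[cite: CaffarelliKohnNirenberg1982, §2 (`E`-quantity); MajdaBertozziCUP2002 §2.3.3] -/
theorem lintegral_normSq_horizontal_hardy_le {ρ : ℝ} (hρ : 0 < ρ) (hρ1 : ρ < 1)
    (hsw : IsSuitableWeakSolutionOn (slab (EuclideanSpace ℝ (Fin 3)) (Iio 0) isOpen_Iio) 0 0 u p)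
    (hH : HasWeakSpatialGradientOn (slab (EuclideanSpace ℝ (Fin 3)) (Iio 0) isOpen_Iio) u H)
    (hgauge : ∀ a : ℝ, 0 < a →
      ENNReal.ofReal (a ^ (2 * ρ)) * cknA a (0 : ℝ × EuclideanSpace ℝ (Fin 3)) u +
          ENNReal.ofReal (a ^ ρ) * cknE a (0 : ℝ × EuclideanSpace ℝ (Fin 3)) H +
        ENNReal.ofReal (a ^ (2 * ρ)) * cknD a (0 : ℝ × EuclideanSpace ℝ (Fin 3)) p ≤ (c : ENNReal))
    (hu : ∀ τ : ℝ, τ < 0 → u τ = selfSimilarCollapse (1 / (2 + ρ)) 0 V τ)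
    (hp : ∀ τ : ℝ, τ < 0 → p τ = selfSimilarCollapsePressure (1 / (2 + ρ)) 0 P τ)
    (hV : ContDiff ℝ 2 V) (hax : IsAxisymmetric V) :
    ∫⁻ y, ENNReal.ofReal ((V y 0 ^ 2 + V y 1 ^ 2) / cylRadius y ^ 2 * ‖y‖ ^ (ρ - 1)) ≤
      ENNReal.ofReal ((1 - ρ) / (2 + ρ)) * (c : ℝ≥0∞) := by
  have hV1 : ContDiff ℝ 1 V := hV.of_le (by norm_num)
  have hd : Differentiable ℝ V := hV1.differentiable (by norm_num)
  refine le_trans (lintegral_mono fun y => ?_) (lintegral_frobeniusNormSq_fderiv_weight_le hρ hρ1 hsw hH hgauge hu hp hV1)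
  rw [ENNReal.ofReal_mul (div_nonneg (by positivity) (sq_nonneg _))]
  exact mul_le_mul' (ENNReal.ofReal_le_ofReal (normSq_horizontal_div_le_frobeniusNormSq hax (hd y))) le_rfl

end SwirlRatchet

end Summit.NavierStokesRegularity.NavierStokesRegularity.Theorems.PowerGaugeEulerLiouville

end
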